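import Literature.Computability.Complexity.StockmeyerEstimator
import HarnessLib

/-!
# A public-coin move as an affine hash: exact one-point count and the miss bound

Toolkit for the PROOF of the Goldwasser–Sipser theorem (`IP[k] ⊆ AM[k+2]`, the named fact
`Literature.Computability.Complexity.GoldwasserSipser1986_IPk_subset_AMk`). In the public-coin
simulation of a private-coin protocol (Arora–Barak §8.2.2–8.2.3) Arthur's move `u ∈ {0,1}^M` is
READ as an affine hash `h_u = coinHash u d b : {0,1}^d → {0,1}^b` over `𝔽₂` (the coin layout of
`StockmeyerEstimator.lean`: row `j < b` = `d` matrix bits and one offset bit starting at coin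
`j (d + 1)`), and Merlin must answer with a string `v` that `h_u` sends to `0`
(`Stockmeyer.HashesToZero u d b v`, the bit-level test a referee performs). This file counts
Arthur's moves, i.e. turns the hash-family statements of `AffineHashing.lean` /
`StockmeyerEstimator.lean` into statements about uniformly random MOVES (equal fibres,
`Stockmeyer.card_filter_coinHash`):

* `card_hashesToZero_mul` — **one-point uniformity**: exactly a `2^{-b}` fraction of the moves
  hash a given `v` to zero (`#{u | h_u(v) = 0} · 2^b = 2^M`); summed against a weight,
  `sum_sum_ite_hashesToZero` (`Σ_u Σ_v [h_u(v) = 0] f v = 2^M / 2^b · Σ_v f v`) — the union-bound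
  half of the set lower bound protocol (AB Claim 8.16.1, upper estimate), in the form the
  SOUNDNESS of the simulation uses;
* `card_forall_not_hashesToZero_mul_le` — **the miss bound** (second moment / Chebyshev,
  `AffineHash.card_badHash_mul_le` with `E = 1`): the moves under which NO element of a set `S`
  hashes to zero are at most a `2^b / |S|` fraction (`#{u | ∀ v ∈ S, h_u(v) ≠ 0} · |S| ≤ 2^b · 2^M`),
  and `card_forall_not_hashesToZero_mul_two_pow_le` (`|S| ≥ 2^{b+γ}` ⇒ at most a `2^{-γ}`
  fraction) — the COMPLETENESS half (AB §8.2.2: "if `|S| ≥ K` the prover can make the verifier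
  accept with high probability"; here with the range `2^b ≤ |S| / 2^γ` well below `|S|`, so that a
  single hash per round suffices).

All statements proved (Mathlib + the two hashing files); no machine here.

## References

* S. Arora, B. Barak, *Computational Complexity: A Modern Approach*, CUP 2009, §8.2.2 (set lower
  bound protocol; Def. 8.14, Claim 8.16.1), §8.2.3 (sketch of Thm. 8.12), Lemma A.12 / Claim A.13
  (Chebyshev for pairwise independent sums).
* S. Goldwasser, M. Sipser, *Private coins versus public coins in interactive proof systems*,
  STOC 1986, §4 (approximate lower bounds by hashing).
-/

namespace Literature.Computability.Complexity

open Finset AffineHash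

open scoped Classical

namespace Stockmeyer

variable {d b M : ℕ}

/-- The moves under which `v` hashes to zero are those whose coin hash sends `toZ v` to `0`.
[folklore] -/
theorem filter_hashesToZero_eq (d b M : ℕ) (v : List.Vector Bool d) :
    (univ.filter fun u : List.Vector Bool M => HashesToZero u.toList d b v.toList) =
      univ.filter fun u : List.Vector Bool M => hash (coinHash u.toList d b) (toZ v) = 0 :=
  filter_congr fun u _ => by rw [hash_coinHash_eq_zero_iff]

/-- **One-point uniformity of the public-coin hash**: for every `v ∈ {0,1}^d`, exactly
`2^M / 2^b` of Arthur's moves `u ∈ {0,1}^M` hash `v` to zero (`b` rows of `d + 1` coins fit in the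
move). [cite: AroraBarakCC2009, Def. 8.14 and Thm. 8.15] -/
theorem card_hashesToZero_mul (hM : b * (d + 1) ≤ M) (v : List.Vector Bool d) :
    (univ.filter fun u : List.Vector Bool M => HashesToZero u.toList d b v.toList).card * 2 ^ b =
      2 ^ M := by
  rw [filter_hashesToZero_eq]
  have h1 : (univ.filter fun u : List.Vector Bool M => hash (coinHash u.toList d b) (toZ v) = 0).card *
      Fintype.card (Hash d b) = (univ.filter fun h : Hash d b => hash h (toZ v) = 0).card * 2 ^ M := by
    convert card_filter_coinHash hM (fun h : Hash d b => hash h (toZ v) = 0)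
  have h2 : (univ.filter fun h : Hash d b => hash h (toZ v) = 0).card * 2 ^ b =
      Fintype.card (Hash d b) := by
    convert card_filter_hash_eq (k := b) (toZ v) 0
  have hH : 0 < Fintype.card (Hash d b) := Fintype.card_pos
  refine Nat.eq_of_mul_eq_mul_right hH ?_
  calc (univ.filter fun u : List.Vector Bool M => hash (coinHash u.toList d b) (toZ v) = 0).card *
        2 ^ b * Fintype.card (Hash d b)
      = (univ.filter fun u : List.Vector Bool M => hash (coinHash u.toList d b) (toZ v) = 0).card *
          Fintype.card (Hash d b) * 2 ^ b := by ring
    _ = (univ.filter fun h : Hash d b => hash h (toZ v) = 0).card * 2 ^ b * 2 ^ M := by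
        rw [h1]; ring
    _ = 2 ^ M * Fintype.card (Hash d b) := by rw [h2]; ring

/-- The same, over `ℝ`: `#{u | h_u(v) = 0} = 2^M / 2^b`. [cite: AroraBarakCC2009, Def. 8.14 and Thm. 8.15] -/
theorem card_hashesToZero_eq_div (hM : b * (d + 1) ≤ M) (v : List.Vector Bool d) :
    ((univ.filter fun u : List.Vector Bool M => HashesToZero u.toList d b v.toList).card : ℝ) =
      2 ^ M / 2 ^ b := by
  rw [eq_div_iff (by positivity)]
  exact_mod_cast card_hashesToZero_mul hM v

/-- **Union-bound form** (the upper half of the set lower bound estimate, AB Claim 8.16.1, summed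
against a weight `f ≥ 0`): `Σ_u Σ_v [h_u(v) = 0] · f v = (2^M / 2^b) · Σ_v f v`.
[cite: AroraBarakCC2009, Claim 8.16.1] -/
theorem sum_sum_ite_hashesToZero (hM : b * (d + 1) ≤ M) (f : List.Vector Bool d → ℝ) :
    ∑ u : List.Vector Bool M, ∑ v : List.Vector Bool d,
        (if HashesToZero u.toList d b v.toList then f v else 0) =
      2 ^ M / 2 ^ b * ∑ v : List.Vector Bool d, f v := by
  rw [sum_comm, mul_sum]
  refine sum_congr rfl fun v _ => ?_
  rw [← sum_filter, sum_const, nsmul_eq_mul, card_hashesToZero_eq_div hM v]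

/-- The moves under which no element of `S` hashes to zero are those whose coin hash has
zero-count `0` on `toZ '' S`. [folklore] -/
theorem filter_forall_not_hashesToZero_eq (d b M : ℕ) (S : Finset (List.Vector Bool d)) :
    (univ.filter fun u : List.Vector Bool M => ∀ v ∈ S, ¬HashesToZero u.toList d b v.toList) =
      univ.filter fun u : List.Vector Bool M =>
        zeroCount (S.map ⟨toZ, toZ_injective⟩) (coinHash u.toList d b) = 0 := by
  refine filter_congr fun u _ => ?_
  rw [zeroCount, card_eq_zero, filter_eq_empty_iff]
  simp only [mem_map, Function.Embedding.coeFn_mk, forall_exists_index, and_imp,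
    forall_apply_eq_imp_iff₂, hash_coinHash_eq_zero_iff]

/-- A hash with zero-count `0` on a set deviates from the mean by the whole set size, so it is
`1`-bad in the sense of `AffineHash.badHash`. [cite: AroraBarakCC2009, Lemma A.12] -/
theorem mem_badHash_one_of_zeroCount_eq_zero {S : Finset (Fin d → ZMod 2)} {h : Hash d b}
    (h0 : zeroCount S h = 0) : h ∈ badHash (k := b) 1 S := by
  rw [badHash, mem_filter]
  refine ⟨mem_univ _, ?_⟩
  simp [dev, h0]

/-- **The miss bound** (Chebyshev / second moment for the pairwise independent affine family):
the moves under which NO element of `S ⊆ {0,1}^d` hashes to zero number at most `2^b · 2^M / |S|`: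
`#{u | ∀ v ∈ S, h_u(v) ≠ 0} · |S| ≤ 2^b · 2^M`. [cite: AroraBarakCC2009, §8.2.2 with Lemma A.12] -/
theorem card_forall_not_hashesToZero_mul_le (hM : b * (d + 1) ≤ M) (S : Finset (List.Vector Bool d)) :
    (univ.filter fun u : List.Vector Bool M => ∀ v ∈ S, ¬HashesToZero u.toList d b v.toList).card *
        S.card ≤ 2 ^ b * 2 ^ M := by
  rw [filter_forall_not_hashesToZero_eq]
  set S' : Finset (Fin d → ZMod 2) := S.map ⟨toZ, toZ_injective⟩ with hS'
  have hcardS : S'.card = S.card := card_map _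
  have hH : 0 < Fintype.card (Hash d b) := Fintype.card_pos
  -- transfer to the hash family
  have h1 : (univ.filter fun u : List.Vector Bool M => zeroCount S' (coinHash u.toList d b) = 0).card *
      Fintype.card (Hash d b) = (univ.filter fun h : Hash d b => zeroCount S' h = 0).card * 2 ^ M := by
    convert card_filter_coinHash hM (fun h : Hash d b => zeroCount S' h = 0)
  -- `#{h | zeroCount = 0} ≤ #badHash 1`, and Chebyshev
  have h2 : (univ.filter fun h : Hash d b => zeroCount S' h = 0).card * S'.card ≤
      2 ^ b * Fintype.card (Hash d b) := by
    calc (univ.filter fun h : Hash d b => zeroCount S' h = 0).card * S'.card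
        ≤ (badHash (k := b) 1 S').card * S'.card :=
          Nat.mul_le_mul_right _ (card_le_card fun h hh =>
            mem_badHash_one_of_zeroCount_eq_zero (mem_filter.1 hh).2)
      _ ≤ 1 ^ 2 * 2 ^ b * Fintype.card (Hash d b) := card_badHash_mul_le 1 S'
      _ = 2 ^ b * Fintype.card (Hash d b) := by ring
  rw [← hcardS]
  refine Nat.le_of_mul_le_mul_right ?_ hH
  calc (univ.filter fun u : List.Vector Bool M => zeroCount S' (coinHash u.toList d b) = 0).card *
        S'.card * Fintype.card (Hash d b)
      = (univ.filter fun u : List.Vector Bool M => zeroCount S' (coinHash u.toList d b) = 0).card *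
          Fintype.card (Hash d b) * S'.card := by ring
    _ = (univ.filter fun h : Hash d b => zeroCount S' h = 0).card * S'.card * 2 ^ M := by
        rw [h1]; ring
    _ ≤ 2 ^ b * Fintype.card (Hash d b) * 2 ^ M := Nat.mul_le_mul_right _ h2
    _ = 2 ^ b * 2 ^ M * Fintype.card (Hash d b) := by ring

/-- **The miss bound for a large set**: if `|S| ≥ 2^{b+γ}` then at most a `2^{-γ}` fraction of
Arthur's moves miss `S` entirely: `#{u | ∀ v ∈ S, h_u(v) ≠ 0} · 2^γ ≤ 2^M`. (The completeness
estimate of one round of the simulation: hashing a set of `≥ 2^{b+γ}` strings into `b` bits, some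
element lands on zero except with probability `2^{-γ}`.) [cite: AroraBarakCC2009, §8.2.2–8.2.3] -/
theorem card_forall_not_hashesToZero_mul_two_pow_le (hM : b * (d + 1) ≤ M) {γ : ℕ}
    {S : Finset (List.Vector Bool d)} (hS : 2 ^ (b + γ) ≤ S.card) :
    (univ.filter fun u : List.Vector Bool M => ∀ v ∈ S, ¬HashesToZero u.toList d b v.toList).card *
        2 ^ γ ≤ 2 ^ M := by
  have h := card_forall_not_hashesToZero_mul_le (b := b) hM S
  have h' : (univ.filter fun u : List.Vector Bool M =>
      ∀ v ∈ S, ¬HashesToZero u.toList d b v.toList).card * 2 ^ (b + γ) ≤ 2 ^ b * 2 ^ M :=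
    (Nat.mul_le_mul_left _ hS).trans h
  rw [pow_add, ← mul_assoc, mul_comm _ (2 ^ b), mul_assoc] at h'
  exact Nat.le_of_mul_le_mul_left h' (by positivity)

/-- The miss bound over `ℝ`: `#{u | ∀ v ∈ S, h_u(v) ≠ 0} ≤ 2^M / 2^γ` when `|S| ≥ 2^{b+γ}`.
[cite: AroraBarakCC2009, §8.2.2–8.2.3] -/
theorem card_forall_not_hashesToZero_le_div (hM : b * (d + 1) ≤ M) {γ : ℕ}
    {S : Finset (List.Vector Bool d)} (hS : 2 ^ (b + γ) ≤ S.card) :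
    ((univ.filter fun u : List.Vector Bool M =>
        ∀ v ∈ S, ¬HashesToZero u.toList d b v.toList).card : ℝ) ≤ 2 ^ M / 2 ^ γ := by
  rw [le_div_iff₀ (by positivity)]
  exact_mod_cast card_forall_not_hashesToZero_mul_two_pow_le hM hS

/-- With `b = 0` rows every string hashes to zero (the empty conjunction). [folklore] -/
theorem hashesToZero_zero (u : List Bool) (d : ℕ) (v : List Bool) : HashesToZero u d 0 v :=
  fun j hj => absurd hj (Nat.not_lt_zero j)

end Stockmeyer

end Literature.Computability.Complexity
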